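import Literature.Computability.Complexity.MurrayWilliams2018Lemma13
import Literature.Computability.Complexity.DiagMachine
import HarnessLib

/-!
# Murray–Williams 2018, Theorem 1.2 for `AC⁰[m]` over the PROVED nondeterministic time hierarchy

Fourth layer under the named facts `MurrayWilliams2018_NTIME_not_depth_ACC` (C. D. Murray,
R. R. Williams, *Circuit lower bounds for nondeterministic quasi-polytime: an easy witness lemma
for NP and NQP*, STOC 2018, Thm. 1.3, threshold-free), `MurrayWilliams2018_NQP_not_ACC` and
`MurrayWilliams2018_NQP_not_subset_ACC0` (`CircuitLowerBounds.lean`).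

`MurrayWilliams2018Transfer.lean` fixes the readings of the two printed components of the
source's proof of Theorem 1.2 for `AC⁰[m]` (§5) — `hEWL` (the easy witness lemma for `NQP`,
Lemma 1.3, derived from Lemma 4.1 in `MurrayWilliams2018Lemma13.lean`) and `hN` (the
nondeterministic simulation `N` of §5; in the source for a UNARY hard language, p. 14: "Take
`L ∈ NTIME[t(n)] − NTIME[t(n)^{1−ε/2}]` such that `L ⊆ {1ⁿ | n ≥ 0}` [SFM78, Žák83]") — and proves
the elementary links between them. The tree PROVES the nondeterministic time hierarchy theorem in
its plain form `ntime_hierarchy` (`Williams2014.lean`; Cook 1973, Seiferas–Fischer–Meyer 1978,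
Žák 1983; Arora–Barak 2009, Thm. 3.2: for time-constructible `f`, `g` with `f(n+1) = o(g(n))`,
`NTIME g ⊄ NTIME f`): `Diag.ntime_hierarchy_holds` (`DiagMachine.lean`, over
`NTIMEHierarchyDiagonal.lean`). Its hard language is binary (the chain words `H ++ 0 1ʲ` of the
diagonalizer); the form with a one-letter hard language quoted by the source (Žák 1983,
Thm. 2.2 — a second diagonalizer, over unary inputs) is neither in the tree nor needed.

This file PROVES the assembly with the hierarchy step supplied by that THEOREM, against the
simulation hypothesis for ARBITRARY (binary) languages — the reading of `hN` of
`MurrayWilliams2018Transfer.lean` minus the clause `IsUnaryLanguage L →`: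

* **`MurrayWilliams2018_thm_1_2_acc_of_EWL_of_simulation`** `(hEWL) (hN)` — Theorem 1.2 for
  `AC⁰[m]` from Lemma 1.3 (level form) and the binary simulation hypothesis; the hierarchy is
  `Diag.ntime_hierarchy_holds` at `f = smoothQPSim E`, `g = smoothQP E` (both time constructible,
  `isTimeConstructible_smoothQPSim`/`isTimeConstructible_smoothQP`; `f(n+1) = o(g(n))`,
  `isLittleO_smoothQPSim_succ`; `SmoothQuasiPoly.lean`);
* **`MurrayWilliams2018_thm_1_2_acc_of_lemma_4_1_ae_of_simulation`**,
  **`MurrayWilliams2018_NQP_not_ACC_of_lemma_4_1_ae_of_simulation`**,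
  **`MurrayWilliams2018_NQP_not_subset_ACC0_of_lemma_4_1_ae_of_simulation`**,
  **`MurrayWilliams2018_NTIME_not_depth_ACC_of_lemma_4_1_ae_of_simulation`** — the three
  Murray–Williams facts over the remaining unproved components ONLY: the Easy Witness Lemma 4.1
  (a.e. form, `MurrayWilliams2018_lemma_4_1_ae`), the simulation of §5 (hypothesis `hN`, binary
  form) and Williams' `ACC`-SAT algorithm `Williams2014_thm_4_1` (J. ACM 2014, Thm. 4.1, giving
  Thm. 5.1 by `MurrayWilliams2018_thm_5_1_of_thm_4_1`). No hierarchy hypothesis is on the list.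

No notion, definition or named fact is introduced (theorems only).

## Faithfulness notes

* The source takes the hard language unary (p. 14 and p. 15: "Take `L ∈ NTIME[t(n)] −
  NTIME[t(n)/2^{log^{ε/2} t(n)}]` such that `L ⊆ {1ⁿ | n ≥ 0}` [SFM78, Žák83] … On an input `1ⁿ`,
  let `N` be a nondeterministic algorithm which: 1. runs in `poly(n)` time to produce a circuit
  `C_n^O`, 2. guesses a witness circuit `W_n` … encoding the oracle `O` for the PCP verifier,
  3. plugs the circuit `W_n` in place of the oracle …, 4. checks satisfiability …", then the
  `EVAL-GATE` circuit `E`, the consistency circuit `D` and the two calls of the `C`-UNSAT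
  algorithm). None of these steps reads the letters of the input: the PCP reduction of
  Ben-Sasson–Viola is quoted for arbitrary `x ∈ {0,1}ⁿ` (p. 14: "given `x ∈ {0,1}ⁿ`, outputs an
  oracle circuit `C_x^O`"), the witness circuits of the Easy Witness Lemma are per input `x`
  (§2), `E` takes `C_x^O` and `W` as inputs, and the running-time analysis depends on `n = |x|`
  only. The source itself runs the argument on a non-unary hard language in Remark 1 (p. 15:
  "Fortnow and Santhanam [FS16] proved that … there is … an `L ∈ NTIME[t(n)]` that is not in
  `NTIME[t(n)^{1−ε/2}]/n^α`. If we use this `L` in the above proof …" — a language hard against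
  `n^α` bits of advice is not unary). Hence the simulation hypothesis for all `L ∈ NTIME[g]`
  (hypothesis `hN` below) is the content of §5 exactly as the unary one is; as a hypothesis it is
  formally stronger (it specialises to the unary one,
  `MurrayWilliams2018_simulation_unary_of_binary`), so the theorems below are formally weaker
  implications than their unary counterparts would be — in exchange the hierarchy they invoke is
  a theorem of the tree. The eventual form of `HasWitnessCircuits` still suffices for a binary
  `L`: the finitely many inputs below the threshold length are decided by table lookup.
* Everything else — levels `NTIME (n ^ (log₂ n)ᵉ)`, the smooth level `g = smoothQP E`, the exact
  `AC⁰[m]`-SAT form `AccSatSubexp`, the reading of the simulation's hypotheses (1)–(5) — is as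
  documented in `MurrayWilliams2018Transfer.lean` (module docstring, "Faithfulness notes"), whose
  proof is followed line by line.

## References

* C. D. Murray, R. R. Williams, *Circuit lower bounds for nondeterministic quasi-polytime: an
  easy witness lemma for NP and NQP*, STOC 2018, 890–901, Thm. 1.2 and its proof (§5, pp. 14–15),
  Remark 1, Thm. 1.3, Thm. 5.1 [MurrayWilliams2018].
* S. Žák, *A Turing machine time hierarchy*, Theoret. Comput. Sci. 26 (1983) 327–333 [Zak1983].
* S. Arora, B. Barak, *Computational Complexity: A Modern Approach*, CUP 2009, Thm. 3.2
  [AroraBarak2009].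
* R. Williams, *Nonuniform ACC circuit lower bounds*, J. ACM 61 (2014), Thm. 4.1 [Williams2014].
-/

noncomputable section

namespace Literature.Computability.Complexity

open _root_.Computability Turing Filter Asymptotics Classes

/-! ### The hierarchy instance -/

/-- **The hard language of the smooth quasi-polynomial level** (the instance of the
nondeterministic time hierarchy theorem used for Theorem 1.2): for `E ≥ 2` some
`L ∈ NTIME (smoothQP E)` (`smoothQP E n ≈ 2^{(log₂ n)^{E+1}}`) is not in `NTIME (smoothQPSim E)`
(`smoothQPSim E = smoothQP E / 2^{(log₂ n)²}`) — `Diag.ntime_hierarchy_holds` with both bounds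
time constructible (`isTimeConstructible_smoothQPSim`, `isTimeConstructible_smoothQP`) and
`smoothQPSim E (n+1) = o(smoothQP E n)` (`isLittleO_smoothQPSim_succ`). This is the source's
"Take `L ∈ NTIME[t(n)] − NTIME[t(n)/2^{log^{ε/2} t(n)}]`" (p. 15) at the tree's smooth level,
without the unary clause. [cite: MurrayWilliams2018, Thm. 1.2 (proof, §5); AroraBarak2009, Thm. 3.2] -/
theorem exists_mem_NTIME_smoothQP_not_mem_smoothQPSim {E : ℕ} (hE : 2 ≤ E) :
    ∃ L : Language Bool, L ∈ NTIME (smoothQP E) ∧ L ∉ NTIME (smoothQPSim E) := by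
  have hE1 : 1 ≤ E := by omega
  exact Set.not_subset_iff_exists_mem_notMem.1 (Diag.ntime_hierarchy_holds (smoothQPSim E)
    (smoothQP E) (isTimeConstructible_smoothQPSim hE) (isTimeConstructible_smoothQP hE1)
    (isLittleO_smoothQPSim_succ hE1))

/-! ### Theorem 1.2 for `AC⁰[m]` over the proved hierarchy -/

/-- **Assembly of Murray–Williams' Theorem 1.2 (for `AC⁰[m]`) over the proved nondeterministic
time hierarchy.** Hypotheses: `hEWL` — the easy witness lemma for `NQP` (Lemma 1.3) at the tree's
levels, in the reading of `MurrayWilliams2018Transfer.lean`; `hN` — the simulation of §5 for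
arbitrary languages (the reading of `MurrayWilliams2018Transfer.lean` without the clause
`IsUnaryLanguage L`).
Proof as printed (§5), by contradiction from (A) "every level has depth-`d`, `2^{log^k n}`-size
`AC⁰[m]` circuits": unrestricted circuits of size `2^{log^{k+2} n}` a.e.
(`eventually_circuitSize_le_of_mem_depthSizeClass`), witness circuits of size `2^{log^K n}` at the
high levels (`hEWL` at `k + 2`), the circuits of `P ⊆ NTIME[n^{log n}]` (`P_subset_NTIME_pow_log`),
`E = (k+1)Kr + 3r`, `g = smoothQP E`, `f = smoothQPSim E`; the hierarchy THEOREM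
(`exists_mem_NTIME_smoothQP_not_mem_smoothQPSim`, from `Diag.ntime_hierarchy_holds`) gives
`L ∈ NTIME[g] ∖ NTIME[f]`, and the simulation puts `L ∈ NTIME[f]`.
[cite: MurrayWilliams2018, Thm. 1.2 (proof, §5) and Remark 1] -/
theorem MurrayWilliams2018_thm_1_2_acc_of_EWL_of_simulation
    (hEWL : ∀ k : ℕ, 1 ≤ k →
      (∀ e : ℕ, 1 ≤ e → ∀ L ∈ NTIME (fun n => n ^ Nat.log 2 n ^ e),
          ∀ᶠ n in atTop, L.circuitSize n ≤ 2 ^ Nat.log 2 n ^ k) →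
        ∃ K e₀ : ℕ, 1 ≤ K ∧ ∀ e : ℕ, e₀ ≤ e →
          NTIMEHasWitnessCircuits (fun n => n ^ Nat.log 2 n ^ e) (fun n => 2 ^ Nat.log 2 n ^ K))
    (hN : ∃ c₀ : ℕ, ∀ (d m k K r : ℕ), 2 ≤ m → 1 ≤ k → 1 ≤ K → 2 ≤ r →
      AccSatSubexp (d + c₀) m r →
      (Classes.P ⊆ ⋃ a : ℕ,
          DepthSizeClass (accBasis m) (fun _ => d) (fun n => a * 2 ^ Nat.log 2 n ^ k + a)) →
      ∀ g : ℕ → ℕ, PolyTimeComputable unaryEncodeNat encodeNat g → (∀ n, n ≤ g n) →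
        (∀ c : ℕ, ∀ᶠ n in atTop, c * Nat.log 2 n ^ (k * K * r) ≤ Nat.log 2 (g n)) →
        ∃ b : ℕ, ∀ (T : ℕ → ℕ) (L : Language Bool), L ∈ NTIME g →
          (∃ a : ℕ, ∀ n, g n * (n + 2) ^ b ≤ a * T n + a) →
          HasWitnessCircuits T L (fun n => 2 ^ Nat.log 2 n ^ K) →
          ∀ f : ℕ → ℕ, (∀ n, n ≤ f n) →
            (∀ᶠ n in atTop,
              g n * Nat.log 2 (g n) ^ b ≤ f n * 2 ^ Nat.nthRoot r (Nat.log 2 (g n))) →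
            L ∈ NTIME f) :
    MurrayWilliams2018_thm_1_2_acc := by
  intro d m hm hsat k
  by_contra hcon
  -- (A): every language of every level `e ≥ 1` has small depth-`d` `AC⁰[m]` circuits
  have hA : ∀ e : ℕ, 1 ≤ e → ∀ L ∈ NTIME (fun n => n ^ Nat.log 2 n ^ e), ∃ c : ℕ,
      L ∈ DepthSizeClass (accBasis m) (fun _ => d) (fun n => c * 2 ^ Nat.log 2 n ^ k + c) := by
    intro e he L hL
    by_contra h
    exact hcon ⟨e, he, L, hL, fun c hc => h ⟨c, hc⟩⟩
  obtain ⟨c₀, hN⟩ := hN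
  obtain ⟨r, hr, hS⟩ := hsat (d + c₀)
  -- (i) unrestricted circuits of size `2^{(log n)^{k+2}}` almost everywhere
  have hSIZE : ∀ e : ℕ, 1 ≤ e → ∀ L ∈ NTIME (fun n => n ^ Nat.log 2 n ^ e),
      ∀ᶠ n in atTop, L.circuitSize n ≤ 2 ^ Nat.log 2 n ^ (k + 2) := by
    intro e he L hL
    obtain ⟨c, hc⟩ := hA e he L hL
    exact eventually_circuitSize_le_of_mem_depthSizeClass hm hc
  -- (ii) witness circuits (Lemma 1.3 at exponent `k + 2`)
  obtain ⟨K, e₀, hK1, he₀⟩ := hEWL (k + 2) (by omega) hSIZE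
  -- (iii) `P` has the assumed circuits (exponent `k + 1 ≥ 1`)
  have hP : Classes.P ⊆ ⋃ a : ℕ,
      DepthSizeClass (accBasis m) (fun _ => d) (fun n => a * 2 ^ Nat.log 2 n ^ (k + 1) + a) := by
    intro L hL
    obtain ⟨c, hc⟩ := hA 1 le_rfl L (P_subset_NTIME_pow_log hL)
    exact Set.mem_iUnion.2 ⟨2 * c, DepthSizeClass_mono le_rfl (fun _ => le_rfl)
      (fun n => mul_two_pow_log_pow_le_succ c k n) hc⟩
  -- (iv) parameters and the hard language, from the hierarchy THEOREM
  have hr1 : 1 ≤ r := by omega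
  have hE1 : 1 ≤ (k + 1) * K * r + 3 * r := by omega
  have hE2 : 2 ≤ (k + 1) * K * r + 3 * r := by omega
  obtain ⟨L, hLg, hLf⟩ := exists_mem_NTIME_smoothQP_not_mem_smoothQPSim hE2
  -- (v) the simulation puts `L` in `NTIME f`
  obtain ⟨b, hb⟩ := hN d m (k + 1) K r hm (by omega) hK1 hr hS hP
    (smoothQP ((k + 1) * K * r + 3 * r)) (polyTimeComputable_smoothQP _)
    (le_smoothQP _) (fun c => eventually_mul_log_pow_le_log_smoothQP _ c _ (Nat.le_add_right _ _))
  refine hLf (hb (fun n => n ^ Nat.log 2 n ^ max e₀ ((k + 1) * K * r + 3 * r + 2)) L hLg ?_ ?_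
    (smoothQPSim ((k + 1) * K * r + 3 * r)) (le_smoothQPSim hE1) ?_)
  · -- the level `T` dominates `g · (n + 2)^b`
    obtain ⟨a, ha⟩ := exists_smoothQP_mul_pow_le ((k + 1) * K * r + 3 * r) b
    refine ⟨a, fun n => (ha n).trans ?_⟩
    exact Nat.add_le_add_right (Nat.mul_le_mul_left a (pow_log_pow_exp_mono (le_max_right _ _) n)) a
  · -- witness circuits at the level `T` (`max e₀ (E + 2) ≥ e₀`), for every verifier of `L`
    exact (he₀ _ (le_max_left _ _)).hasWitnessCircuits L
  · -- the savings inequality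
    exact eventually_smoothQP_mul_log_pow_le hr1 (by omega) b

/-! ### Over the remaining components: Lemma 4.1 (a.e.), the simulation, Williams' Theorem 4.1 -/

/-- **Murray–Williams' Theorem 1.2 for `AC⁰[m]` from Lemma 4.1 (a.e. form) and the simulation of
§5 (binary form)** — the hierarchy being the theorem `Diag.ntime_hierarchy_holds` and Lemma 1.3
being `MurrayWilliams2018_lemma_1_3_of_lemma_4_1_ae`. [cite: MurrayWilliams2018, Thm. 1.2 (proof, §5)] -/
theorem MurrayWilliams2018_thm_1_2_acc_of_lemma_4_1_ae_of_simulation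
    (h41 : MurrayWilliams2018_lemma_4_1_ae)
    (hN : ∃ c₀ : ℕ, ∀ (d m k K r : ℕ), 2 ≤ m → 1 ≤ k → 1 ≤ K → 2 ≤ r →
      AccSatSubexp (d + c₀) m r →
      (Classes.P ⊆ ⋃ a : ℕ,
          DepthSizeClass (accBasis m) (fun _ => d) (fun n => a * 2 ^ Nat.log 2 n ^ k + a)) →
      ∀ g : ℕ → ℕ, PolyTimeComputable unaryEncodeNat encodeNat g → (∀ n, n ≤ g n) →
        (∀ c : ℕ, ∀ᶠ n in atTop, c * Nat.log 2 n ^ (k * K * r) ≤ Nat.log 2 (g n)) →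
        ∃ b : ℕ, ∀ (T : ℕ → ℕ) (L : Language Bool), L ∈ NTIME g →
          (∃ a : ℕ, ∀ n, g n * (n + 2) ^ b ≤ a * T n + a) →
          HasWitnessCircuits T L (fun n => 2 ^ Nat.log 2 n ^ K) →
          ∀ f : ℕ → ℕ, (∀ n, n ≤ f n) →
            (∀ᶠ n in atTop,
              g n * Nat.log 2 (g n) ^ b ≤ f n * 2 ^ Nat.nthRoot r (Nat.log 2 (g n))) →
            L ∈ NTIME f) :
    MurrayWilliams2018_thm_1_2_acc :=
  MurrayWilliams2018_thm_1_2_acc_of_EWL_of_simulation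
    (MurrayWilliams2018_lemma_1_3_of_lemma_4_1_ae h41) hN

/-- **`MurrayWilliams2018_NQP_not_ACC` over the remaining components**: Lemma 4.1 (a.e. form),
the simulation of §5 (binary form) and Williams' `ACC`-SAT algorithm (J. ACM 2014, Thm. 4.1,
giving Thm. 5.1 by `MurrayWilliams2018_thm_5_1_of_thm_4_1`); the hierarchy is the theorem
`Diag.ntime_hierarchy_holds`. [cite: MurrayWilliams2018, §1.1, Thm. 1.2, Thm. 5.1] -/
theorem MurrayWilliams2018_NQP_not_ACC_of_lemma_4_1_ae_of_simulation
    (h41 : MurrayWilliams2018_lemma_4_1_ae)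
    (hN : ∃ c₀ : ℕ, ∀ (d m k K r : ℕ), 2 ≤ m → 1 ≤ k → 1 ≤ K → 2 ≤ r →
      AccSatSubexp (d + c₀) m r →
      (Classes.P ⊆ ⋃ a : ℕ,
          DepthSizeClass (accBasis m) (fun _ => d) (fun n => a * 2 ^ Nat.log 2 n ^ k + a)) →
      ∀ g : ℕ → ℕ, PolyTimeComputable unaryEncodeNat encodeNat g → (∀ n, n ≤ g n) →
        (∀ c : ℕ, ∀ᶠ n in atTop, c * Nat.log 2 n ^ (k * K * r) ≤ Nat.log 2 (g n)) →
        ∃ b : ℕ, ∀ (T : ℕ → ℕ) (L : Language Bool), L ∈ NTIME g →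
          (∃ a : ℕ, ∀ n, g n * (n + 2) ^ b ≤ a * T n + a) →
          HasWitnessCircuits T L (fun n => 2 ^ Nat.log 2 n ^ K) →
          ∀ f : ℕ → ℕ, (∀ n, n ≤ f n) →
            (∀ᶠ n in atTop,
              g n * Nat.log 2 (g n) ^ b ≤ f n * 2 ^ Nat.nthRoot r (Nat.log 2 (g n))) →
            L ∈ NTIME f)
    (hW : Williams2014_thm_4_1) : MurrayWilliams2018_NQP_not_ACC :=
  MurrayWilliams2018_NQP_not_ACC_of_thm_1_2_acc
    (MurrayWilliams2018_thm_1_2_acc_of_lemma_4_1_ae_of_simulation h41 hN)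
    (MurrayWilliams2018_thm_5_1_of_thm_4_1 hW)

/-- **The headline `¬ (NQP ⊆ ACC⁰)` (`MurrayWilliams2018_NQP_not_subset_ACC0`) over the same
remaining components.** [cite: MurrayWilliams2018, §1.1 and Thm. 1.3] -/
theorem MurrayWilliams2018_NQP_not_subset_ACC0_of_lemma_4_1_ae_of_simulation
    (h41 : MurrayWilliams2018_lemma_4_1_ae)
    (hN : ∃ c₀ : ℕ, ∀ (d m k K r : ℕ), 2 ≤ m → 1 ≤ k → 1 ≤ K → 2 ≤ r →
      AccSatSubexp (d + c₀) m r →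
      (Classes.P ⊆ ⋃ a : ℕ,
          DepthSizeClass (accBasis m) (fun _ => d) (fun n => a * 2 ^ Nat.log 2 n ^ k + a)) →
      ∀ g : ℕ → ℕ, PolyTimeComputable unaryEncodeNat encodeNat g → (∀ n, n ≤ g n) →
        (∀ c : ℕ, ∀ᶠ n in atTop, c * Nat.log 2 n ^ (k * K * r) ≤ Nat.log 2 (g n)) →
        ∃ b : ℕ, ∀ (T : ℕ → ℕ) (L : Language Bool), L ∈ NTIME g →
          (∃ a : ℕ, ∀ n, g n * (n + 2) ^ b ≤ a * T n + a) →
          HasWitnessCircuits T L (fun n => 2 ^ Nat.log 2 n ^ K) →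
          ∀ f : ℕ → ℕ, (∀ n, n ≤ f n) →
            (∀ᶠ n in atTop,
              g n * Nat.log 2 (g n) ^ b ≤ f n * 2 ^ Nat.nthRoot r (Nat.log 2 (g n))) →
            L ∈ NTIME f)
    (hW : Williams2014_thm_4_1) : MurrayWilliams2018_NQP_not_subset_ACC0 :=
  (MurrayWilliams2018_NQP_not_ACC_of_lemma_4_1_ae_of_simulation h41 hN hW).not_subset_ACC0

/-- **Theorem 1.3 (threshold-free form, `MurrayWilliams2018_NTIME_not_depth_ACC`) over the same
remaining components** — Lemma 4.1 (a.e. form), the simulation of §5 (binary form), Williams'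
Theorem 4.1 (`MurrayWilliams2018_NTIME_not_depth_ACC_of_thm_1_2_of_thm_4_1`,
`Williams2014AccSat.lean`); the hierarchy is the theorem `Diag.ntime_hierarchy_holds`.
[cite: MurrayWilliams2018, Thm. 1.3] -/
theorem MurrayWilliams2018_NTIME_not_depth_ACC_of_lemma_4_1_ae_of_simulation
    (h41 : MurrayWilliams2018_lemma_4_1_ae)
    (hN : ∃ c₀ : ℕ, ∀ (d m k K r : ℕ), 2 ≤ m → 1 ≤ k → 1 ≤ K → 2 ≤ r →
      AccSatSubexp (d + c₀) m r →
      (Classes.P ⊆ ⋃ a : ℕ,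
          DepthSizeClass (accBasis m) (fun _ => d) (fun n => a * 2 ^ Nat.log 2 n ^ k + a)) →
      ∀ g : ℕ → ℕ, PolyTimeComputable unaryEncodeNat encodeNat g → (∀ n, n ≤ g n) →
        (∀ c : ℕ, ∀ᶠ n in atTop, c * Nat.log 2 n ^ (k * K * r) ≤ Nat.log 2 (g n)) →
        ∃ b : ℕ, ∀ (T : ℕ → ℕ) (L : Language Bool), L ∈ NTIME g →
          (∃ a : ℕ, ∀ n, g n * (n + 2) ^ b ≤ a * T n + a) →
          HasWitnessCircuits T L (fun n => 2 ^ Nat.log 2 n ^ K) →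
          ∀ f : ℕ → ℕ, (∀ n, n ≤ f n) →
            (∀ᶠ n in atTop,
              g n * Nat.log 2 (g n) ^ b ≤ f n * 2 ^ Nat.nthRoot r (Nat.log 2 (g n))) →
            L ∈ NTIME f)
    (hW : Williams2014_thm_4_1) : MurrayWilliams2018_NTIME_not_depth_ACC :=
  MurrayWilliams2018_NTIME_not_depth_ACC_of_thm_1_2_of_thm_4_1
    (MurrayWilliams2018_thm_1_2_acc_of_lemma_4_1_ae_of_simulation h41 hN) hW

/-- **The unary simulation hypothesis is a special case of the binary one**: the source's form
of the simulation hypothesis (unary `L`, in the reading of `MurrayWilliams2018Transfer.lean`)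
follows from the binary form used in this file, so every consumer of the unary
decomposition is served by the binary one. [cite: MurrayWilliams2018, Thm. 1.2 (proof, §5)] -/
theorem MurrayWilliams2018_simulation_unary_of_binary
    (hN : ∃ c₀ : ℕ, ∀ (d m k K r : ℕ), 2 ≤ m → 1 ≤ k → 1 ≤ K → 2 ≤ r →
      AccSatSubexp (d + c₀) m r →
      (Classes.P ⊆ ⋃ a : ℕ,
          DepthSizeClass (accBasis m) (fun _ => d) (fun n => a * 2 ^ Nat.log 2 n ^ k + a)) →
      ∀ g : ℕ → ℕ, PolyTimeComputable unaryEncodeNat encodeNat g → (∀ n, n ≤ g n) →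
        (∀ c : ℕ, ∀ᶠ n in atTop, c * Nat.log 2 n ^ (k * K * r) ≤ Nat.log 2 (g n)) →
        ∃ b : ℕ, ∀ (T : ℕ → ℕ) (L : Language Bool), L ∈ NTIME g →
          (∃ a : ℕ, ∀ n, g n * (n + 2) ^ b ≤ a * T n + a) →
          HasWitnessCircuits T L (fun n => 2 ^ Nat.log 2 n ^ K) →
          ∀ f : ℕ → ℕ, (∀ n, n ≤ f n) →
            (∀ᶠ n in atTop,
              g n * Nat.log 2 (g n) ^ b ≤ f n * 2 ^ Nat.nthRoot r (Nat.log 2 (g n))) →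
            L ∈ NTIME f) :
    ∃ c₀ : ℕ, ∀ (d m k K r : ℕ), 2 ≤ m → 1 ≤ k → 1 ≤ K → 2 ≤ r →
      AccSatSubexp (d + c₀) m r →
      (Classes.P ⊆ ⋃ a : ℕ,
          DepthSizeClass (accBasis m) (fun _ => d) (fun n => a * 2 ^ Nat.log 2 n ^ k + a)) →
      ∀ g : ℕ → ℕ, PolyTimeComputable unaryEncodeNat encodeNat g → (∀ n, n ≤ g n) →
        (∀ c : ℕ, ∀ᶠ n in atTop, c * Nat.log 2 n ^ (k * K * r) ≤ Nat.log 2 (g n)) →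
        ∃ b : ℕ, ∀ (T : ℕ → ℕ) (L : Language Bool), IsUnaryLanguage L → L ∈ NTIME g →
          (∃ a : ℕ, ∀ n, g n * (n + 2) ^ b ≤ a * T n + a) →
          HasWitnessCircuits T L (fun n => 2 ^ Nat.log 2 n ^ K) →
          ∀ f : ℕ → ℕ, (∀ n, n ≤ f n) →
            (∀ᶠ n in atTop,
              g n * Nat.log 2 (g n) ^ b ≤ f n * 2 ^ Nat.nthRoot r (Nat.log 2 (g n))) →
            L ∈ NTIME f := by
  obtain ⟨c₀, h⟩ := hN
  refine ⟨c₀, fun d m k K r hm hk hK hr hS hP g hg hgn hlog => ?_⟩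
  obtain ⟨b, hb⟩ := h d m k K r hm hk hK hr hS hP g hg hgn hlog
  exact ⟨b, fun T L _ hL hT hw f hf hfg => hb T L hL hT hw f hf hfg⟩

end Literature.Computability.Complexity

end
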